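import Literature.Barriers.PneNP.TSPExtensionComplexityRothvossAssembly
import HarnessLib

/-!
# The level sets `Q_c(t)` of the odd-cut slack matrix are nonempty

Rothvoß's level sets `Q_ℓ = {(U, M) : |U| = t, |δ(U) ∩ M| = ℓ}` of the pairs (odd `t`-cut, perfect matching)
of `K_n` (`Literature.Barriers.PneNP.Qset n t ℓ`) [cite: Rothvoss2017, §2 (PDF p. 6)] carry the uniform
measures `μ_ℓ` of the rectangle-covering argument, whose normalisations `1/|Q_ℓ|` presuppose `Q_ℓ ≠ ∅`
("`⟨W, S⟩ = 1`" uses `|Q_3| > 0` [cite: Rothvoss2017, §2 (PDF p. 6, eq. (2))]; the tree's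
`qset_three_nonempty` is the case `ℓ = 3`).  This file PROVES the general statement (no named facts):

* `qset_nonempty` — for `n` even, `t` odd, `c` odd with `c ≤ t` and `t + c ≤ n`, `Q_c(t) ≠ ∅`: a `t`-set `U`,
  `c` disjoint crossing edges between `c` points of `U` and `c` points outside, completed by perfect
  matchings inside `U` and inside its complement (both of even size);
* `qset_nonempty_of_two_mul_add_two_le` — the form consumed by exact extrapolation designs on the `t`-cuts
  (`Literature.Combinatorics.Optimization.IsExactDesign`: `t` odd, `2t + 2 ≤ n`, odd levels `3 ≤ c ≤ T ≤ t`,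
  "every used level class nonempty").
-/

noncomputable section

open Finset

namespace Literature.Combinatorics.Optimization

open Literature.Barriers.PneNP
open Literature.Combinatorics.SimpleGraph.CycleSpace (Crosses crosses_mk)

variable {n : ℕ}

/-- A perfect "crossing" matching between two disjoint `c`-sets `X`, `Y`: `c` edges, each joining a point
of `X` to a point of `Y`. [folklore] -/
private theorem exists_crossing_matching :
    ∀ (c : ℕ) (X Y : Finset (Fin n)), X.card = c → Y.card = c → Disjoint X Y →
      ∃ M : Finset (Sym2 (Fin n)), IsPMOn (X ∪ Y) M ∧ M.card = c ∧
        ∀ e ∈ M, ∃ x ∈ X, ∃ y ∈ Y, e = s(x, y) := by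
  intro c
  induction c with
  | zero =>
    intro X Y hX hY _
    rw [Finset.card_eq_zero] at hX hY
    subst hX
    subst hY
    refine ⟨∅, by simpa using (IsPMOn.empty : IsPMOn (∅ : Finset (Fin n)) ∅), rfl,
      fun e he => (Finset.notMem_empty e he).elim⟩
  | succ c ih =>
    intro X Y hX hY hd
    obtain ⟨x, hx⟩ : X.Nonempty := card_pos.1 (by omega)
    obtain ⟨y, hy⟩ : Y.Nonempty := card_pos.1 (by omega)
    have hxy : x ≠ y := fun h => disjoint_left.1 hd hx (h ▸ hy)
    obtain ⟨M', hM', hcard', hE'⟩ := ih (X.erase x) (Y.erase y)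
      (by rw [card_erase_of_mem hx, hX]; rfl) (by rw [card_erase_of_mem hy, hY]; rfl)
      (hd.mono (erase_subset _ _) (erase_subset _ _))
    have hd' : Disjoint ({x, y} : Finset (Fin n)) (X.erase x ∪ Y.erase y) := by
      rw [disjoint_insert_left, disjoint_singleton_left, mem_union, mem_union, not_or, not_or]
      exact ⟨⟨notMem_erase x X, fun h => disjoint_left.1 hd hx (mem_of_mem_erase h)⟩,
        ⟨fun h => disjoint_left.1 hd (mem_of_mem_erase h) hy, notMem_erase y Y⟩⟩
    have hPM := (IsPMOn.pair hxy).union hM' hd'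
    have hS : ({x, y} : Finset (Fin n)) ∪ (X.erase x ∪ Y.erase y) = X ∪ Y := by
      ext v
      simp only [mem_union, mem_insert, mem_singleton, mem_erase]
      constructor
      · rintro ((rfl | rfl) | ⟨-, h⟩ | ⟨-, h⟩)
        · exact Or.inl hx
        · exact Or.inr hy
        · exact Or.inl h
        · exact Or.inr h
      · rintro (h | h)
        · by_cases hv : v = x
          · exact Or.inl (Or.inl hv)
          · exact Or.inr (Or.inl ⟨hv, h⟩)
        · by_cases hv : v = y
          · exact Or.inl (Or.inr hv)
          · exact Or.inr (Or.inr ⟨hv, h⟩)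
    rw [hS] at hPM
    have hnot : s(x, y) ∉ M' := by
      intro h
      obtain ⟨x', hx', y', hy', he⟩ := hE' _ h
      rcases Sym2.eq_iff.1 he with ⟨h1, -⟩ | ⟨h1, -⟩
      · subst h1
        exact (notMem_erase _ X) hx'
      · subst h1
        exact disjoint_left.1 hd hx (mem_of_mem_erase hy')
    refine ⟨{s(x, y)} ∪ M', hPM, ?_, ?_⟩
    · rw [← insert_eq, card_insert_of_notMem hnot, hcard']
    · intro e he
      rcases mem_union.1 he with he | he
      · rw [mem_singleton] at he
        exact ⟨x, hx, y, hy, he⟩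
      · obtain ⟨x', hx', y', hy', he'⟩ := hE' e he
        exact ⟨x', mem_of_mem_erase hx', y', mem_of_mem_erase hy', he'⟩

/-- **The level sets `Q_c(t)` are nonempty**: for `n` even, `t` odd and `c` odd with `c ≤ t`, `t + c ≤ n`
there is a `t`-subset `U` of `[n]` and a perfect matching `M` of `K_n` with exactly `c` edges crossing `U`
(`|δ(U) ∩ M| = c`). [cite: Rothvoss2017, §2 (PDF p. 6)] -/
theorem qset_nonempty (hn : Even n) {t c : ℕ} (ht : Odd t) (hc : Odd c) (hct : c ≤ t)
    (htc : t + c ≤ n) : (Qset n t c).Nonempty := by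
  classical
  obtain ⟨U, -, hU⟩ := Finset.exists_subset_card_eq (s := (univ : Finset (Fin n))) (n := t)
    (by rw [card_univ, Fintype.card_fin]; omega)
  have hUc : Uᶜ.card = n - t := by rw [card_compl, Fintype.card_fin, hU]
  obtain ⟨X, hXU, hX⟩ := Finset.exists_subset_card_eq (s := U) (n := c) (by omega)
  obtain ⟨Y, hYU, hY⟩ := Finset.exists_subset_card_eq (s := Uᶜ) (n := c) (by omega)
  have hUUc : Disjoint U Uᶜ := disjoint_compl_right
  obtain ⟨M₀, hM₀, hcard₀, hE₀⟩ := exists_crossing_matching c X Y hX hY (hUUc.mono hXU hYU)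
  have h1 : Even (U \ X).card := by
    rw [card_sdiff_of_subset hXU, hU, hX]
    exact Nat.Odd.sub_odd ht hc
  have h2 : Even (Uᶜ \ Y).card := by
    rw [card_sdiff_of_subset hYU, hUc, hY]
    exact Nat.Odd.sub_odd (Nat.Even.sub_odd (by omega) hn ht) hc
  obtain ⟨M₁, hM₁⟩ := exists_isPMOn_of_even _ _ rfl h1
  obtain ⟨M₂, hM₂⟩ := exists_isPMOn_of_even _ _ rfl h2
  have hd1 : Disjoint (X ∪ Y) (U \ X) :=
    disjoint_union_left.2 ⟨disjoint_sdiff, hUUc.symm.mono hYU sdiff_subset⟩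
  have hd2 : Disjoint ((X ∪ Y) ∪ (U \ X)) (Uᶜ \ Y) :=
    disjoint_union_left.2 ⟨disjoint_union_left.2 ⟨hUUc.mono hXU sdiff_subset, disjoint_sdiff⟩,
      hUUc.mono sdiff_subset sdiff_subset⟩
  have hPM := (hM₀.union hM₁ hd1).union hM₂ hd2
  have hS : (X ∪ Y) ∪ (U \ X) ∪ (Uᶜ \ Y) = univ := by
    ext v
    simp only [mem_union, mem_sdiff, mem_compl, mem_univ, iff_true]
    by_cases hvU : v ∈ U
    · by_cases hvX : v ∈ X
      · exact Or.inl (Or.inl (Or.inl hvX))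
      · exact Or.inl (Or.inr ⟨hvU, hvX⟩)
    · by_cases hvY : v ∈ Y
      · exact Or.inl (Or.inl (Or.inr hvY))
      · exact Or.inr ⟨hvU, hvY⟩
  rw [hS] at hPM
  refine ⟨(⟨U, by rw [hU]; exact ht⟩, ⟨_, hPM⟩), ?_⟩
  rw [mem_Qset_iff]
  refine ⟨hU, ?_⟩
  -- exactly the `c` crossing edges `M₀` cross `U`
  have hfilter : (M₀ ∪ M₁ ∪ M₂).filter (Crosses U) = M₀ := by
    ext e
    simp only [mem_filter, mem_union]
    constructor
    · rintro ⟨(h | h) | h, hcr⟩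
      · exact h
      · exfalso
        obtain ⟨a, b, rfl, ha, hb⟩ := crosses_iff_exists.1 hcr
        have hab := Finset.mk_mem_sym2_iff.1 (hM₁.subset_sym2 h)
        exact hb (mem_sdiff.1 hab.2).1
      · exfalso
        obtain ⟨a, b, rfl, ha, hb⟩ := crosses_iff_exists.1 hcr
        have hab := Finset.mk_mem_sym2_iff.1 (hM₂.subset_sym2 h)
        exact (mem_compl.1 (mem_sdiff.1 hab.1).1) ha
    · intro h
      refine ⟨Or.inl (Or.inl h), ?_⟩
      obtain ⟨x, hx, y, hy, rfl⟩ := hE₀ e h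
      rw [crosses_mk]
      exact Or.inl ⟨hXU hx, mem_compl.1 (hYU hy)⟩
  show ((M₀ ∪ M₁ ∪ M₂).filter (Crosses U)).card = c
  rw [hfilter, hcard₀]

/-- The form used by exact extrapolation designs on balanced `t`-cuts (`IsExactDesign`: `t` odd,
`2t + 2 ≤ n`, odd levels `c ≤ t`): every level class `Q_c(t)` is nonempty.
[cite: Rothvoss2017, §2 (PDF p. 6)] -/
theorem qset_nonempty_of_two_mul_add_two_le (hn : Even n) {t c : ℕ} (ht : Odd t)
    (h2t : 2 * t + 2 ≤ n) (hc : Odd c) (hct : c ≤ t) : (Qset n t c).Nonempty :=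
  qset_nonempty hn ht hc hct (by omega)

end Literature.Combinatorics.Optimization
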